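import Mathlib
import Literature.NumberTheory.Transcendental.ZagierDilogarithmConjecture
import Literature.NumberTheory.Transcendental.PreBlochGroup
import Literature.NumberTheory.Transcendental.PreBlochHalf
import Summits.KontsevichZagierPeriods.KontsevichZagierPeriods.Theorems.HyperbolicBlochZagierDilogarithmConjectureStubTwoSaturation
import Summits.KontsevichZagierPeriods.KontsevichZagierPeriods.Theorems.HyperbolicBlochZagierDilogarithmConjectureStubSaturation
import HarnessLib

/-!
# `ZagierDilogarithmConjecture` (stmt-KontsevichZagierPeriods-10550) — line
`kummer-clausen-linearisation` (reshape c1), stub `stub_nSaturation`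

**`n`-saturation of the dilogarithm relator group, conditional on Suslin's theorem.** If
`n • x` (`n ≥ 1`) lies in the subgroup `C = ⟨dilogRelators⟩` of `ℤ[ℂ]` (five-term elements with
algebraic entries, `[w] + [w̄]` for algebraic `w`, `[r]` for real `r`), then so does `x`: the full
"`ℤ`-form ⇔ `ℚ`-form" of Zagier's conjecture (Neumann 1998, remark after Thm. 2.10 [Neumann1998]),
from the unique divisibility of the pre-Bloch group `P(ℚ̄)`, `ℚ̄ = algebraicClosure ℚ ℂ`
(Dupont 2001, Thm. 8.16, after Suslin 1991 [Dupont2001]) taken as the HYPOTHESIS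
`Suslin1991_preBloch_isUniquelyDivisible` (the tree's named fact).

This statement is ALREADY in the tree, verbatim, as `stub_saturation` (module
`…Theorems.HyperbolicBlochZagierDilogarithmConjectureStubSaturation`, proved there by the argument
of the landed case `n = 2`, `stub_twoSaturation`: support split of `ℤ[ℂ]` along `ℚ̄`, the symbol
map `Φ : ℤ[ℂ] → P(ℚ̄)`, the conjugation-fixed image of the symmetric relators, which is
`n`-saturated as soon as `n • (·)` is injective on `P(ℚ̄)`, and the pull-back of the five-term
relators of `ℤ[ℚ̄ ∖ {0,1}]`). This file only gives it the name registered for the stub of the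
reshaped skeleton (c1); nothing is re-proved.
-/

noncomputable section

open Literature.NumberTheory.Transcendental

namespace Summit.KontsevichZagierPeriods.HyperbolicBloch.ZagierDilogarithm

/-- **`n`-saturation of the dilogarithm relator group** (stub `stub_nSaturation` of line
`kummer-clausen-linearisation`, reshape c1): under Suslin's theorem (unique divisibility of `P(F)`
for `F` algebraically closed of characteristic `0`, Dupont 2001 Thm. 8.16 — the hypothesis), if
`n • x ∈ ⟨dilogRelators⟩ ⊆ ℤ[ℂ]` with `n ≥ 1` then `x ∈ ⟨dilogRelators⟩` ("`ℤ`-form ⇔ `ℚ`-form",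
Neumann 1998, remark after Thm. 2.10). The registered name for the tree's `stub_saturation`
(same statement, same namespace). [cite: Dupont2001, Thm. 8.16] -/
theorem stub_nSaturation :
    Suslin1991_preBloch_isUniquelyDivisible →
      ∀ n : ℕ, 0 < n → ∀ x : FreeAbelianGroup ℂ, n • x ∈ AddSubgroup.closure dilogRelators →
        x ∈ AddSubgroup.closure dilogRelators :=
  stub_saturation

end Summit.KontsevichZagierPeriods.HyperbolicBloch.ZagierDilogarithm

end
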